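import Mathlib
import HarnessLib
import Summits.NavierStokesRegularity.NavierStokesRegularity.Theses.PoloidalWindowDoor

/-!
# Crux `PoloidalWindowRigidity` (K2, stmt-NavierStokesRegularity-19708) — CENSUS-C2-g8, typed companion (IDEATOR ns-idea-8, generation 8)

Definitions only (no stubs, no claims of proof): the two LARGE-SCALE LAWS of the route's Type-I Oseen-mild class found while hunting a
kill for the ridge cells C2a/C2b of HL3′, typed so that a later seat or a refuter can attach to them by name.  Both are (I claim, with
proof sketches in `CENSUS-C2-g8.md`) TRUE class-wide and both are TOOTHLESS against C2a/C2b (codimension barrier B-g8-2) and against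
the (OSC) wall of the (TH) column (B-g8-1).  They are recorded as banked context, not as line obligations.  No summit is proved by any
line; NS regularity is NOT proved.
-/

noncomputable section

set_option linter.dupNamespace false

namespace Summit.NavierStokesRegularity.NavierStokesRegularity.Cruxes.PoloidalWindowRigidity.CensusG8

open Set Function MeasureTheory
open scoped InnerProductSpace RealInnerProductSpace

/-- The point of the horizontal plane through `c` with in-plane coordinates `p = (a, b)`: `c + a e₀ + b e₁`. -/
def planePt (c : EuclideanSpace ℝ (Fin 3)) (p : ℝ × ℝ) : EuclideanSpace ℝ (Fin 3) :=
  c + p.1 • EuclideanSpace.single 0 1 + p.2 • EuclideanSpace.single 1 1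

/-- **PZ (plane zero mode), class-wide, uniform in the plane.**  For a profile of the route's class and every `t < 0`, the mean of
the NORMAL component `v₂(t)` over the square of side `2R` centred anywhere on any horizontal plane tends to `0` as `R → ∞`,
uniformly in the centre: `|∫_{[-R,R]²} v₂(t, c + a e₀ + b e₁) d(a,b)| ≤ ε·4R²` for `R ≥ R₀(C,t,ε)`.  (Sketch: the flat-box zero
mode Z of LINE 16 for translates, uniform in the centre because its estimate depends on `C, s, t` only, plus the LEAKAGE bound
`|square mean at height z − square mean at height z₀| ≤ 2|z − z₀|·‖v(t)‖_∞/R` from `div v = 0`; Fourier reason: at horizontal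
frequency `0` the Leray projector kills the normal–normal momentum flux.)  Consequences: NoHotPlane in one line; `v₂(t,·)` changes
sign on every horizontal plane; in the (TH) global form `|S| ≤ osc θ`.  Blind to ridges (codimension 2). -/
def PlaneZeroMode : Prop :=
  ∀ (C : ℝ) (v : ℝ → EuclideanSpace ℝ (Fin 3) → EuclideanSpace ℝ (Fin 3)),
    Literature.Analysis.FluidPDE.HasTypeITimeDecay C v →
    ContinuousOn (Function.uncurry v) (Set.Iio (0 : ℝ) ×ˢ Set.univ) →
    (∀ s t : ℝ, s < t → t < 0 → ∀ x, v t x =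
      Literature.Analysis.UnboundedOperators.heatExtension (v s) (t - s) x -
        Literature.Analysis.FluidPDE.oseenDuhamel 1 s v v t x) →
    (∀ t < 0, Literature.Analysis.FluidPDE.VectorCalculus.IsDivFree (v t)) →
    ∀ t : ℝ, t < 0 → ∀ ε : ℝ, 0 < ε → ∃ R₀ : ℝ, 0 < R₀ ∧ ∀ R : ℝ, R₀ ≤ R →
      ∀ c : EuclideanSpace ℝ (Fin 3),
        |∫ p in Set.Icc (-R) R ×ˢ Set.Icc (-R) R, v t (planePt c p) 2| ≤ ε * (4 * R ^ 2)

/-- **EZ (energy zero mode), class-wide, uniform in the centre.**  For a profile of the route's class and every `t < 0` there is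
`K = K(C,t)` with `∫_{B_R(c)} |v(t)|² ≤ K R²` for all `R ≥ R₀` and all centres `c` — one power of `R` better than the trivial `R³`
and one power WORSE than the scale-critical `R` (Morrey/CKN-type `sup_R R⁻¹ ∫_{B_R}|v|²`).  (Sketch: two-time local energy
inequality on `B_R` from `s = −R²`, where Type-I gives `∫_{B_R}|v(s)|² ≤ (4π/3) C² R`, to `t`, the cubic and pressure fluxes through
`∂B_R` costing `≲ R² C³/√(−t)` with the class pressure `p ∼ |v|²`.)  Inside EnergySupercriticality: no ε-regularity or Liouville
statement of the tree consumes an `R²` bound; flat boxes give no gain; the doubly periodic case is the only one it trivialises. -/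
def EnergyZeroMode : Prop :=
  ∀ (C : ℝ) (v : ℝ → EuclideanSpace ℝ (Fin 3) → EuclideanSpace ℝ (Fin 3)),
    Literature.Analysis.FluidPDE.HasTypeITimeDecay C v →
    ContinuousOn (Function.uncurry v) (Set.Iio (0 : ℝ) ×ˢ Set.univ) →
    (∀ s t : ℝ, s < t → t < 0 → ∀ x, v t x =
      Literature.Analysis.UnboundedOperators.heatExtension (v s) (t - s) x -
        Literature.Analysis.FluidPDE.oseenDuhamel 1 s v v t x) →
    (∀ t < 0, Literature.Analysis.FluidPDE.VectorCalculus.IsDivFree (v t)) →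
    ∀ t : ℝ, t < 0 → ∃ K : ℝ, 0 < K ∧ ∃ R₀ : ℝ, 0 < R₀ ∧ ∀ R : ℝ, R₀ ≤ R →
      ∀ c : EuclideanSpace ℝ (Fin 3), ∫ x in Metric.closedBall c R, ‖v t x‖ ^ 2 ≤ K * R ^ 2

end Summit.NavierStokesRegularity.NavierStokesRegularity.Cruxes.PoloidalWindowRigidity.CensusG8

end
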